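import Mathlib

/-!
# Tier4/Common/AdicResidue — the residue field of the integers of the `v`-adic completion of a number field is
FINITE (the missing Mathlib fact (M1) behind the local compactness of the finite adeles, S12378)

Blind re-derivation cell `pub-hodge-repro`, Tier 4 (README §9–§10), seat t4-typer-2 (gen 0).  Target tree path
`lean/Summits/Ventures/HodgeRepro/Tier4/Common/AdicResidue.lean`.  Mathlib only.

THE STATEMENT.  `K` a number field, `v` a finite place (`HeightOneSpectrum (𝓞 K)`), `K_v = v.adicCompletion K`,
`𝒪_v = v.adicCompletionIntegers K` (the valuation subring `Valued.v ≤ 1`).  The ring homomorphism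
`𝓞 K → 𝒪_v → κ(𝒪_v) = IsLocalRing.ResidueField 𝒪_v` is SURJECTIVE (`residue_algebraMap_surjective`): given
`x ∈ 𝒪_v`, density of `K` in `K_v` gives `y ∈ K` with `v(x − y) < 1`, so `y` lies in the valuation ring of `K` at `v`,
i.e. in the localisation `𝓞_{K,(v)}` (`valuationSubringAtPrime_eq_valuationSubring`), `y = a / s` with `s ∉ v`;
`v` is maximal, so `s s′ ≡ 1 (mod v)` for some `s′ ∈ 𝓞 K` (`Ideal.IsMaximal.exists_inv`), and `r := a s′ ∈ 𝓞 K`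
satisfies `v(y − r) < 1`; hence `x ≡ r` modulo the maximal ideal.  Its kernel contains `v`
(`residue_algebraMap_eq_zero_of_mem`), so it factors through the FINITE quotient `𝓞 K ⧸ v`
(`Ideal.finiteQuotientOfFreeOfNeBot`): **`finite_residueField`**.  Mathlib's criterion
`Valued.LocallyCompact.compactSpace_iff_completeSpace_and_isDiscreteValuationRing_and_finite_residueField`
then gives `CompactSpace 𝒪[K_v]` (`compactSpace_integer`) and `ProperSpace K_v` / `LocallyCompactSpace K_v`
(`properSpace_adicCompletion`); Mathlib's restricted-product instance then gives **`locallyCompactSpace_finiteAdeleRing`**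
and **`locallyCompactSpace_adeleRing`** — the local compactness of `𝔸_K` that S12378 named as the Mathlib gap behind
Haar measures on the adelic groups of the cell.

Nothing here says anything about the status of the Hodge conjecture for CM abelian varieties, which is NOT proved
(HC_CM is NOT proved by anyone in this repository).
-/

set_option autoImplicit false

noncomputable section

namespace Summit.Ventures.HodgeRepro.Tier4.Common

open IsDedekindDomain HeightOneSpectrum NumberField
open scoped NumberField

section Residue

variable (K : Type) [Field K] [NumberField K] (v : HeightOneSpectrum (𝓞 K))

/-- The valuation of an element of `K`, read in the completion, is the global valuation. -/
theorem valued_coe (y : K) : Valued.v (algebraMap K (v.adicCompletion K) y) = v.valuation K y :=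
  valuedAdicCompletion_eq_valuation' v y

/-- The open ball `{z | v(z − x) < 1}` is open. -/
theorem isOpen_ball_one (x : v.adicCompletion K) : IsOpen {z : v.adicCompletion K | Valued.v (z - x) < 1} := by
  have h : IsOpen {z : v.adicCompletion K | Valued.v z < 1} := by
    have := Valued.isOpen_ball (v.adicCompletion K)
      (1 : MonoidWithZeroHom.ValueGroup₀ (.ofClass (Valued.v : Valuation (v.adicCompletion K) _)))
    simpa [Valuation.restrict_lt_iff_lt_embedding] using this
  have : {z : v.adicCompletion K | Valued.v (z - x) < 1} = (fun z => z - x) ⁻¹' {z | Valued.v z < 1} := rfl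
  rw [this]
  exact h.preimage (continuous_id.sub continuous_const)

/-- **Approximation by global integers**: every element `x` of the completion with `v(x) ≤ 1` is within
`v(·) < 1` of the image of a global integer. -/
theorem exists_int_valued_sub_lt_one (x : v.adicCompletion K) (hx : Valued.v x ≤ 1) :
    ∃ r : 𝓞 K, Valued.v (x - algebraMap (𝓞 K) (v.adicCompletion K) r) < 1 := by
  -- density: some `y ∈ K` with `v(y − x) < 1`
  obtain ⟨y, hy⟩ := (denseRange_algebraMap (K := K) (v := v)).exists_mem_open (isOpen_ball_one K v x) ⟨x, by simp⟩
  simp only [Set.mem_setOf_eq] at hy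
  -- `v(y) ≤ 1`
  have hy1 : v.valuation K y ≤ 1 := by
    rw [← valued_coe K v]
    calc Valued.v (algebraMap K (v.adicCompletion K) y)
        = Valued.v ((algebraMap K (v.adicCompletion K) y - x) + x) := by rw [sub_add_cancel]
      _ ≤ max (Valued.v (algebraMap K (v.adicCompletion K) y - x)) (Valued.v x) := Valuation.map_add _ _ _
      _ ≤ 1 := max_le hy.le hx
  -- `y` lies in the valuation ring of `K` at `v`, i.e. `y = a / s` with `s ∉ v`
  have hmem : y ∈ valuationSubringAtPrime K v := by
    rw [valuationSubringAtPrime_eq_valuationSubring]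
    exact hy1
  obtain ⟨a, s, hs, hy_eq⟩ := hmem
  -- an inverse of `s` modulo `v`
  obtain ⟨s', i, hi, hss'⟩ := v.isMaximal.exists_inv hs
  refine ⟨a * s', ?_⟩
  have hs0 : (algebraMap (𝓞 K) K s) ≠ 0 := by
    intro h0
    apply hs
    have : s = 0 := (map_eq_zero_iff _ (FaithfulSMul.algebraMap_injective (𝓞 K) K)).mp h0
    rw [this]
    exact v.asIdeal.zero_mem
  -- the difference `y − a s′ = a i / s`
  have hdiff : y - algebraMap (𝓞 K) K (a * s') = algebraMap (𝓞 K) K a * algebraMap (𝓞 K) K i / algebraMap (𝓞 K) K s := by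
    rw [hy_eq]
    have hi' : algebraMap (𝓞 K) K i = 1 - algebraMap (𝓞 K) K s' * algebraMap (𝓞 K) K s := by
      rw [← map_mul, ← map_one (algebraMap (𝓞 K) K), ← hss']
      simp
    rw [hi', map_mul]
    field_simp
  -- its valuation is `< 1`
  have hval : v.valuation K (y - algebraMap (𝓞 K) K (a * s')) < 1 := by
    rw [hdiff, map_div₀, map_mul]
    have ha : v.valuation K (algebraMap (𝓞 K) K a) ≤ 1 := valuation_le_one v a
    have hi1 : v.valuation K (algebraMap (𝓞 K) K i) < 1 := (valuation_lt_one_iff_mem v i).mpr hi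
    have hs1 : v.valuation K (algebraMap (𝓞 K) K s) = 1 := (valuation_eq_one_iff_notMem v).mpr hs
    rw [hs1, div_one]
    calc v.valuation K (algebraMap (𝓞 K) K a) * v.valuation K (algebraMap (𝓞 K) K i)
        ≤ 1 * v.valuation K (algebraMap (𝓞 K) K i) := by gcongr
      _ = v.valuation K (algebraMap (𝓞 K) K i) := one_mul _
      _ < 1 := hi1
  -- assemble: `x − r = (x − y) + (y − r)`
  have hcoe : algebraMap (𝓞 K) (v.adicCompletion K) (a * s') =
      algebraMap K (v.adicCompletion K) (algebraMap (𝓞 K) K (a * s')) := by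
    rw [IsScalarTower.algebraMap_apply (𝓞 K) K (v.adicCompletion K)]
  rw [hcoe]
  have e : x - algebraMap K (v.adicCompletion K) (algebraMap (𝓞 K) K (a * s')) =
      -(algebraMap K (v.adicCompletion K) y - x) +
        algebraMap K (v.adicCompletion K) (y - algebraMap (𝓞 K) K (a * s')) := by
    rw [map_sub]; abel
  rw [e]
  calc Valued.v (-(algebraMap K (v.adicCompletion K) y - x) +
        algebraMap K (v.adicCompletion K) (y - algebraMap (𝓞 K) K (a * s')))
      ≤ max (Valued.v (-(algebraMap K (v.adicCompletion K) y - x)))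
          (Valued.v (algebraMap K (v.adicCompletion K) (y - algebraMap (𝓞 K) K (a * s')))) :=
        Valuation.map_add _ _ _
    _ < 1 := by
        rw [Valuation.map_neg, valued_coe K v]
        exact max_lt hy hval

/-- The residue map of the integers of the completion. -/
abbrev residueOfInt : v.adicCompletionIntegers K →+* IsLocalRing.ResidueField (v.adicCompletionIntegers K) :=
  IsLocalRing.residue (v.adicCompletionIntegers K)

/-- An element of the integers with `v(·) < 1` lies in the maximal ideal. -/
theorem mem_maximalIdeal_of_valued_lt_one (a : v.adicCompletionIntegers K) (ha : Valued.v (a : v.adicCompletion K) < 1) :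
    a ∈ IsLocalRing.maximalIdeal (v.adicCompletionIntegers K) :=
  (Valuation.mem_maximalIdeal_iff (v := (Valued.v : Valuation (v.adicCompletion K) _)) (a := a)).mpr ha

/-- **The global integers surject onto the residue field of the local integers.** -/
theorem residue_algebraMap_surjective :
    Function.Surjective ((residueOfInt K v).comp (algebraMap (𝓞 K) (v.adicCompletionIntegers K))) := by
  intro xbar
  obtain ⟨x, rfl⟩ := IsLocalRing.residue_surjective xbar
  obtain ⟨r, hr⟩ := exists_int_valued_sub_lt_one K v (x : v.adicCompletion K) x.2
  refine ⟨r, ?_⟩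
  simp only [RingHom.comp_apply, residueOfInt]
  rw [← sub_eq_zero, ← map_sub, IsLocalRing.residue_eq_zero_iff]
  -- `algebraMap r − x` is in the maximal ideal
  have hmem : algebraMap (𝓞 K) (v.adicCompletionIntegers K) r - x ∈ IsLocalRing.maximalIdeal (v.adicCompletionIntegers K) := by
    apply mem_maximalIdeal_of_valued_lt_one
    show Valued.v (algebraMap (𝓞 K) (v.adicCompletion K) r - (x : v.adicCompletion K)) < 1
    rw [← Valuation.map_neg, neg_sub]
    exact hr
  exact hmem

/-- The kernel of `𝓞 K → κ(𝒪_v)` contains `v`. -/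
theorem residue_algebraMap_eq_zero_of_mem {r : 𝓞 K} (hr : r ∈ v.asIdeal) :
    (residueOfInt K v).comp (algebraMap (𝓞 K) (v.adicCompletionIntegers K)) r = 0 := by
  simp only [RingHom.comp_apply, residueOfInt]
  rw [IsLocalRing.residue_eq_zero_iff]
  apply mem_maximalIdeal_of_valued_lt_one
  show Valued.v (algebraMap K (v.adicCompletion K) (algebraMap (𝓞 K) K r)) < 1
  rw [valued_coe K v]
  exact (valuation_lt_one_iff_mem v r).mpr hr

/-- The induced map from the finite quotient `𝓞 K ⧸ v` onto the residue field. -/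
def residueOfQuotient : (𝓞 K ⧸ v.asIdeal) →+* IsLocalRing.ResidueField (v.adicCompletionIntegers K) :=
  Ideal.Quotient.lift v.asIdeal ((residueOfInt K v).comp (algebraMap (𝓞 K) (v.adicCompletionIntegers K)))
    fun _ hr => residue_algebraMap_eq_zero_of_mem K v hr

/-- The induced map is surjective. -/
theorem residueOfQuotient_surjective : Function.Surjective (residueOfQuotient K v) := by
  intro xbar
  obtain ⟨r, hr⟩ := residue_algebraMap_surjective K v xbar
  exact ⟨Ideal.Quotient.mk v.asIdeal r, by rw [residueOfQuotient, Ideal.Quotient.lift_mk]; exact hr⟩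

/-- **(M1) The residue field of the integers of the completion is finite.** -/
theorem finite_residueField : Finite (IsLocalRing.ResidueField (v.adicCompletionIntegers K)) := by
  haveI : Finite (𝓞 K ⧸ v.asIdeal) := Ideal.finiteQuotientOfFreeOfNeBot v.asIdeal v.ne_bot
  exact Finite.of_surjective _ (residueOfQuotient_surjective K v)

/-! ## Compactness and local compactness of the completion -/

open Valued in
/-- `𝒪[K_v]` (the `Valued.integer` subring) is the same subtype as `adicCompletionIntegers`, so its residue
field is finite. -/
theorem finite_residueField_integer :
    Finite (IsLocalRing.ResidueField (Valued.integer (v.adicCompletion K))) :=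
  finite_residueField K v

/-- **(M1) The integers of the completion are compact.** -/
theorem compactSpace_integer : CompactSpace (Valued.integer (v.adicCompletion K)) := by
  haveI : CompleteSpace (Valued.integer (v.adicCompletion K)) :=
    (Valued.isClosed_integer (v.adicCompletion K)).completeSpace_coe
  haveI : IsDiscreteValuationRing (Valued.integer (v.adicCompletion K)) :=
    inferInstanceAs (IsDiscreteValuationRing (v.adicCompletionIntegers K))
  haveI : Finite (IsLocalRing.ResidueField (Valued.integer (v.adicCompletion K))) :=
    finite_residueField_integer K v
  exact (Valued.integer.compactSpace_iff_completeSpace_and_isDiscreteValuationRing_and_finite_residueField).mpr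
    ⟨inferInstance, inferInstance, inferInstance⟩

/-- **The `v`-adic completion of a number field is a proper (hence locally compact) space.** -/
theorem properSpace_adicCompletion : ProperSpace (v.adicCompletion K) :=
  (Valued.integer.properSpace_iff_compactSpace_integer).mpr (compactSpace_integer K v)

/-- Local compactness of the completion. -/
theorem locallyCompactSpace_adicCompletion : LocallyCompactSpace (v.adicCompletion K) :=
  haveI := properSpace_adicCompletion K v
  inferInstance

/-- Compactness of `adicCompletionIntegers` (the `ValuationSubring` form). -/
theorem compactSpace_adicCompletionIntegers : CompactSpace (v.adicCompletionIntegers K) :=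
  compactSpace_integer K v

end Residue

/-! ## Local compactness of the finite adele ring and of the adele ring -/

section Adeles

open scoped RestrictedProduct

variable (K : Type) [Field K] [NumberField K]

/-- **The finite adele ring of a number field is locally compact** (a restricted product of locally compact groups
along compact open subgroups — Mathlib's `RestrictedProduct` instance, fed by `compactSpace_adicCompletionIntegers`). -/
theorem locallyCompactSpace_finiteAdeleRing : LocallyCompactSpace (FiniteAdeleRing (𝓞 K) K) := by
  haveI : ∀ v : HeightOneSpectrum (𝓞 K), CompactSpace (v.adicCompletionIntegers K) :=
    fun v => compactSpace_adicCompletionIntegers K v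
  haveI : Fact (∀ v : HeightOneSpectrum (𝓞 K), IsOpen (v.adicCompletionIntegers K : Set (v.adicCompletion K))) :=
    ⟨fun _ ↦ Valued.isOpen_valuationSubring _⟩
  exact inferInstanceAs (LocallyCompactSpace (RestrictedProduct (fun v : HeightOneSpectrum (𝓞 K) => v.adicCompletion K)
    (fun v => (v.adicCompletionIntegers K : Set (v.adicCompletion K))) Filter.cofinite))

/-- **The adele ring of a number field is locally compact** (`𝔸_K = 𝔸_{K,∞} × 𝔸_{K,f}`, both locally compact). -/
theorem locallyCompactSpace_adeleRing : LocallyCompactSpace (AdeleRing (𝓞 K) K) := by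
  haveI := locallyCompactSpace_finiteAdeleRing K
  exact inferInstanceAs (LocallyCompactSpace (InfiniteAdeleRing K × FiniteAdeleRing (𝓞 K) K))

end Adeles


end Summit.Ventures.HodgeRepro.Tier4.Common

end
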